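import Summits.QuantumFields.BalabanUV.Beta.GAN24.ArrowOperator
import Summits.QuantumFields.BalabanUV.Beta.GAN24.ArrowNorms

/-!
# `BalabanUV.Beta.GAN24.ArrowAnchorDecoupled` — binder row G-an2-4 / (CONV-C), road P1-fibre, p1 row **P1-L10** `FibreStrip` ((I3′)), L10 owner leaf-16's cut
# «(M4) scaled alias-space Neumann, two anchors» (= SKELETON-P1 A5 v0.3), row **F3** `ArrowAnchorZero` (INNER ANCHOR), part 2 = THE GENERIC DECOUPLED ANCHOR in
# F1a/F1b currency: an arrow matrix whose border weights vanish off ONE distinguished alias `m₀`, whose block at `m₀` vanishes, whose other blocks are invertible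
# with `‖(T m)⁻¹‖ ≤ t` (`t ≥ 1`) and whose `m₀`-couplings have modulus `≥ 1` is invertible with `‖inverse‖ ≤ t` — the shape of `arrowMat (innerArrow N 0)`
# (part 3 `GAN24/ArrowAnchorZero`, on F1c `ArrowScaling`: blocks `unitKKT` with `t = 5/2` by F1d `ArrowUnitBlock`, couplings EXACTLY `1`, off-zero borders `0` by
# part 1 `GAN24/ArrowAnchorZeroMomenta`)

NOT IN PRINT; OUR PROOF ATTEMPT (of the road; THIS file is [folklore] finite-dimensional linear algebra over `ℂ` in the Euclidean operator norm, over F1a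
`GAN24/ArrowOperator` + F1b `GAN24/ArrowNorms` BY NAME).  HONEST FRAMING (cell contract, verbatim): «discharging `BetaPertH` makes Bałaban's UV stability
UNCONDITIONAL — a real constructive-QFT result; it is NOT the continuum limit and NOT the Clay problem.»  HONEST DEPENDENCY (verbatim): «continuum YM on T⁴ ⇐
BetaPertH ∧ nine spine estimates (0/9 proved); BetaPertH ⇐ (D1) ∧ (D4) ∧ CAP+tail; G-an2-4 gates asym, D1 and NE2/3/4.»  No cited fact, no `def`, no `def … : Prop`
hypothesis, no wall binder; nothing of the K-slot of (CONV-C) is discharged here.  NOT summit progress.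

## What is proved (abstract arrow data `X : ArrowData D ι`; `arrowMat`, `locW`, `borW`, `arrowMat_mulVec_inl/inr` of F1a; norms as in F1b)
* §1 component bookkeeping: `‖v‖₂² = Σ_s ‖v s‖²` on the slots, the local/border split of a vector on `AIdx D ι` (`eq_sumElim`), the one-alias split
  `Σ_m f m = f m₀ + Σ_{m ≠ m₀} f m`, and `w·a = b`, `1 ≤ ‖w‖ ⇒ ‖a‖ ≤ ‖b‖`.
* §2 **`apriori_decoupled`**: under (h0) `X.T m₀ = 0`, (hT) `m ≠ m₀ ⇒ IsUnit (X.T m) ∧ ‖(X.T m)⁻¹‖ ≤ t` with `1 ≤ t`, (hloc/hbor) `m ≠ m₀ ⇒ X.locW m = 0`, `X.borW m = 0`,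
  (hloc0/hbor0) `1 ≤ ‖X.locW m₀ s‖`, `1 ≤ ‖X.borW m₀ s‖` for every slot `s`:  `‖(xl, xb)‖₂ ≤ t · ‖arrowMat X (xl, xb)‖₂`
  (solve: `xl(·,m) = (T m)⁻¹ y(·,m)` for `m ≠ m₀`; `xb s = −y(s,m₀)/locW m₀ s`; `xl(s,m₀) = y_b s/borW m₀ s`; then `‖x‖² ≤ t²‖y‖²` slice by slice via `ArrowNorms.norm_sq_toLp_prod`).
* §3 **`isUnit_decoupled`**: hence `IsUnit (arrowMat X) ∧ ‖(arrowMat X)⁻¹‖ ≤ t` (`ArrowNorms.isUnit_and_norm_inv_le_of_apriori`).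
This is the «`ape_decoupled`» anchor of `L10-CUT-M4.md` §3 row F1/F3 (not in F1b, which carries the bordered anchor `isUnit_bordered` of F5).
Unit `b2b-balaban-gan24-formalise-leaf-15` (G-an2-4 formalisation swarm; `CLAIM P1-L10-F3` journal 2026-08-20T00:42Z), 2026-08-20.  Value = the anchor lemma
of the inner Neumann step (F4/F7) of L10's route; NOT (I3′), NOT the K-slot.
-/

noncomputable section

open Matrix WithLp Complex Finset
open scoped Matrix.Norms.L2Operator InnerProductSpace BigOperators
open Summit.QuantumFields.BalabanUV.Beta.GAN24.BorderedFrameInverseBlocks (norm_sq_toLp_sumElim)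
open Summit.QuantumFields.BalabanUV.Beta.GAN24.ArrowOperator
open Summit.QuantumFields.BalabanUV.Beta.GAN24.ArrowOperator.ArrowData
open Summit.QuantumFields.BalabanUV.Beta.GAN24.ArrowNorms (norm_sq_toLp_prod norm_toLp_mulVec_le isUnit_and_norm_inv_le_of_apriori norm_le_of_sq_le)

namespace Summit.QuantumFields.BalabanUV.Beta.GAN24.ArrowAnchorDecoupled

variable {D : ℕ} {ι : Type*} [Fintype ι] [DecidableEq ι]

/-! ## §1 Component bookkeeping -/

/-- [folklore] `‖v‖₂² = Σ_s ‖v s‖²` for a vector on the slots. -/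
theorem norm_sq_toLp_eq_sum {l : Type*} [Fintype l] (v : l → ℂ) : ‖(toLp 2 v : EuclideanSpace ℂ l)‖ ^ 2 = ∑ s, ‖v s‖ ^ 2 := by
  rw [EuclideanSpace.norm_sq_eq]

omit [Fintype ι] [DecidableEq ι] in
/-- [folklore] A vector on `AIdx` is the `Sum.elim` of its local and border halves. -/
theorem eq_sumElim (y : AIdx D ι → ℂ) : y = Sum.elim (fun i => y (Sum.inl i)) (fun s => y (Sum.inr s)) := by
  funext i; cases i <;> rfl

/-- [folklore] THE ONE-ALIAS SPLIT of a sum of nonnegative reals: `Σ_m f m = f m₀ + Σ_{m ≠ m₀} f m`. -/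
theorem sum_eq_add_sum_erase (f : ι → ℝ) (m₀ : ι) : ∑ m, f m = f m₀ + ∑ m ∈ Finset.univ.erase m₀, f m :=
  (Finset.add_sum_erase Finset.univ f (Finset.mem_univ m₀)).symm

/-- [folklore] Division by a weight of modulus `≥ 1` does not increase the modulus: `w·a = b`, `1 ≤ ‖w‖` ⇒ `‖a‖ ≤ ‖b‖`. -/
theorem norm_le_of_mul_eq {w a b : ℂ} (h : w * a = b) (hw : 1 ≤ ‖w‖) : ‖a‖ ≤ ‖b‖ := by
  rw [← h, norm_mul]
  exact le_mul_of_one_le_left (norm_nonneg _) hw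

/-! ## §2 The decoupled a-priori bound -/

/-- [folklore] **THE DECOUPLED A-PRIORI BOUND.**  Arrow data `X` with a distinguished alias `m₀` such that: the block at `m₀` vanishes, every other block is
invertible with `‖(T m)⁻¹‖ ≤ t` (`t ≥ 1`), the border weights of every other alias vanish, and the `m₀` border weights have modulus `≥ 1`.  Then
`‖(xl, xb)‖₂ ≤ t · ‖arrowMat X (xl, xb)‖₂`.  (At `p = 0` in the inner scaling: `m₀ = 0`, blocks `unitKKT`, `t = 5/2`, couplings `= 1`.) -/
theorem apriori_decoupled (X : ArrowData D ι) (m₀ : ι) {t : ℝ} (ht1 : 1 ≤ t) (h0 : X.T m₀ = 0)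
    (hT : ∀ m, m ≠ m₀ → IsUnit (X.T m) ∧ ‖(X.T m)⁻¹‖ ≤ t)
    (hloc : ∀ m, m ≠ m₀ → X.locW m = 0) (hbor : ∀ m, m ≠ m₀ → X.borW m = 0)
    (hloc0 : ∀ s, 1 ≤ ‖X.locW m₀ s‖) (hbor0 : ∀ s, 1 ≤ ‖X.borW m₀ s‖)
    (xl : Loc D × ι → ℂ) (xb : Loc D → ℂ) :
    ‖(toLp 2 (Sum.elim xl xb) : EuclideanSpace ℂ (AIdx D ι))‖
      ≤ t * ‖(toLp 2 (arrowMat X *ᵥ Sum.elim xl xb) : EuclideanSpace ℂ (AIdx D ι))‖ := by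
  have ht0 : 0 ≤ t := zero_le_one.trans ht1
  set y : AIdx D ι → ℂ := arrowMat X *ᵥ Sum.elim xl xb with hy
  -- per-alias slices of the unknowns and of the local rows
  set v : ι → Loc D → ℂ := fun m s => xl (s, m) with hv
  set w : ι → Loc D → ℂ := fun m s => y (Sum.inl (s, m)) with hw
  set yb : Loc D → ℂ := fun s => y (Sum.inr s) with hyb
  -- the row identities
  have hrow : ∀ m s, y (Sum.inl (s, m)) = (X.T m *ᵥ v m) s - X.locW m s * xb s := fun m s => by
    rw [hy, arrowMat_mulVec_inl]
  have hbrow : ∀ s, y (Sum.inr s) = ∑ m, X.borW m s * xl (s, m) := fun s => by rw [hy, arrowMat_mulVec_inr]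
  -- (i) m ≠ m₀: v m = (T m)⁻¹ w m, ‖v m‖ ≤ t ‖w m‖
  have hi : ∀ m, m ≠ m₀ → ‖(toLp 2 (v m) : EuclideanSpace ℂ (Loc D))‖ ≤ t * ‖(toLp 2 (w m) : EuclideanSpace ℂ (Loc D))‖ := by
    intro m hm
    obtain ⟨hU, hTm⟩ := hT m hm
    have hdet : IsUnit (X.T m).det := (isUnit_iff_isUnit_det _).1 hU
    have hwm : w m = X.T m *ᵥ v m := by
      funext s
      show y (Sum.inl (s, m)) = _
      rw [hrow, hloc m hm, Pi.zero_apply, zero_mul, sub_zero]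
    have hvm : v m = (X.T m)⁻¹ *ᵥ w m := by rw [hwm, mulVec_mulVec, nonsing_inv_mul _ hdet, one_mulVec]
    rw [hvm]
    exact (norm_toLp_mulVec_le _ _).trans (mul_le_mul_of_nonneg_right hTm (norm_nonneg _))
  -- (ii) m₀ local rows pin xb: ‖xb s‖ ≤ ‖w m₀ s‖
  have hii : ∀ s, ‖xb s‖ ≤ ‖w m₀ s‖ := by
    intro s
    have e : w m₀ s = -(X.locW m₀ s * xb s) := by
      show y (Sum.inl (s, m₀)) = _
      rw [hrow, h0, zero_mulVec, Pi.zero_apply, zero_sub]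
    have e' : X.locW m₀ s * xb s = -w m₀ s := by rw [e, neg_neg]
    have := norm_le_of_mul_eq e' (hloc0 s)
    rwa [norm_neg] at this
  -- (iii) border rows pin v m₀: ‖v m₀ s‖ ≤ ‖yb s‖
  have hiii : ∀ s, ‖v m₀ s‖ ≤ ‖yb s‖ := by
    intro s
    have e : yb s = X.borW m₀ s * v m₀ s := by
      show y (Sum.inr s) = _
      rw [hbrow, Finset.sum_eq_single m₀ (fun m _ hm => by rw [hbor m hm, Pi.zero_apply, zero_mul]) (fun h => absurd (Finset.mem_univ _) h)]
    exact norm_le_of_mul_eq e.symm (hbor0 s)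
  -- squared norms
  have hx2 : ‖(toLp 2 (Sum.elim xl xb) : EuclideanSpace ℂ (AIdx D ι))‖ ^ 2
      = (∑ m, ‖(toLp 2 (v m) : EuclideanSpace ℂ (Loc D))‖ ^ 2) + ∑ s, ‖xb s‖ ^ 2 := by
    rw [norm_sq_toLp_sumElim, norm_sq_toLp_prod, norm_sq_toLp_eq_sum]
  have hy2 : ‖(toLp 2 y : EuclideanSpace ℂ (AIdx D ι))‖ ^ 2
      = (∑ m, ‖(toLp 2 (w m) : EuclideanSpace ℂ (Loc D))‖ ^ 2) + ∑ s, ‖yb s‖ ^ 2 := by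
    conv_lhs => rw [eq_sumElim y]
    rw [norm_sq_toLp_sumElim, norm_sq_toLp_prod, norm_sq_toLp_eq_sum]
  -- assemble: ‖x‖² ≤ t² ‖y‖²
  have hv0 : ‖(toLp 2 (v m₀) : EuclideanSpace ℂ (Loc D))‖ ^ 2 ≤ ∑ s, ‖yb s‖ ^ 2 := by
    rw [norm_sq_toLp_eq_sum]
    exact Finset.sum_le_sum fun s _ => pow_le_pow_left₀ (norm_nonneg _) (hiii s) 2
  have hxb : ∑ s, ‖xb s‖ ^ 2 ≤ ‖(toLp 2 (w m₀) : EuclideanSpace ℂ (Loc D))‖ ^ 2 := by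
    rw [norm_sq_toLp_eq_sum]
    exact Finset.sum_le_sum fun s _ => pow_le_pow_left₀ (norm_nonneg _) (hii s) 2
  have hrest : ∑ m ∈ Finset.univ.erase m₀, ‖(toLp 2 (v m) : EuclideanSpace ℂ (Loc D))‖ ^ 2
      ≤ t ^ 2 * ∑ m ∈ Finset.univ.erase m₀, ‖(toLp 2 (w m) : EuclideanSpace ℂ (Loc D))‖ ^ 2 := by
    rw [Finset.mul_sum]
    refine Finset.sum_le_sum fun m hm => ?_
    rw [← mul_pow]
    exact pow_le_pow_left₀ (norm_nonneg _) (hi m (Finset.ne_of_mem_erase hm)) 2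
  have ht2 : 1 ≤ t ^ 2 := one_le_pow₀ ht1
  have hsq : ‖(toLp 2 (Sum.elim xl xb) : EuclideanSpace ℂ (AIdx D ι))‖ ^ 2 ≤ (t * ‖(toLp 2 y : EuclideanSpace ℂ (AIdx D ι))‖) ^ 2 := by
    rw [hx2, mul_pow, hy2, sum_eq_add_sum_erase _ m₀, sum_eq_add_sum_erase (fun m => ‖(toLp 2 (w m) : EuclideanSpace ℂ (Loc D))‖ ^ 2) m₀]
    have hA : 0 ≤ ∑ s, ‖yb s‖ ^ 2 := Finset.sum_nonneg fun s _ => sq_nonneg _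
    have hB : 0 ≤ ‖(toLp 2 (w m₀) : EuclideanSpace ℂ (Loc D))‖ ^ 2 := sq_nonneg _
    nlinarith [mul_le_mul_of_nonneg_left (hv0.trans (le_mul_of_one_le_left hA ht2)) zero_le_one,
      hxb.trans (le_mul_of_one_le_left hB ht2), hrest]
  exact norm_le_of_sq_le _ (mul_nonneg ht0 (norm_nonneg _)) hsq

/-! ## §3 The decoupled anchor -/

/-- [folklore] **THE DECOUPLED ANCHOR**: under the hypotheses of `apriori_decoupled`, `arrowMat X` is invertible with `‖(arrowMat X)⁻¹‖ ≤ t`. -/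
theorem isUnit_decoupled (X : ArrowData D ι) (m₀ : ι) {t : ℝ} (ht1 : 1 ≤ t) (h0 : X.T m₀ = 0)
    (hT : ∀ m, m ≠ m₀ → IsUnit (X.T m) ∧ ‖(X.T m)⁻¹‖ ≤ t)
    (hloc : ∀ m, m ≠ m₀ → X.locW m = 0) (hbor : ∀ m, m ≠ m₀ → X.borW m = 0)
    (hloc0 : ∀ s, 1 ≤ ‖X.locW m₀ s‖) (hbor0 : ∀ s, 1 ≤ ‖X.borW m₀ s‖) :
    IsUnit (arrowMat X) ∧ ‖(arrowMat X)⁻¹‖ ≤ t := by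
  refine isUnit_and_norm_inv_le_of_apriori (zero_le_one.trans ht1) fun x => ?_
  have hx : x = Sum.elim (fun i => x (Sum.inl i)) (fun s => x (Sum.inr s)) := eq_sumElim x
  rw [hx]
  exact apriori_decoupled X m₀ ht1 h0 hT hloc hbor hloc0 hbor0 _ _

end Summit.QuantumFields.BalabanUV.Beta.GAN24.ArrowAnchorDecoupled

end
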